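import Summits.NavierStokesRegularity.NavierStokesRegularity.Theorems.ScaledTopAlignmentGigaMiuraTypeI
import Summits.NavierStokesRegularity.NavierStokesRegularity.Theorems.ScaledTopAlignmentBulkFatou
import Summits.NavierStokesRegularity.NavierStokesRegularity.Theorems.SymmetryModuliCountLiouvilleKillsTypeI
import HarnessLib

/-!
# Route `ScaledTopAlignment`: the door may be restricted to NEAR-MAXIMUM vorticity points —
# scaled sign-blind alignment at points with `|ω(t,x)| ≥ κ/(T − t)`, plus no Type II, gives Clay (A)
# (support for W3 = `AprioriScaledTopAlignment`, stmt-NavierStokesRegularity-19901)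

The route's deciding theorem (`Theses.ScaledTopAlignment.closes`, and the tree bridge
`navierStokesRegularity_of_aprioriScaledTopAlignment_of_noTypeII`) consumes the door W3 only along the
Type-I zoom of GAP″, i.e. at physical points `x_j + λ_j y` whose vorticity is `≈ ν|Ω(y)|/λ_j²`. Along the
PARABOLIC zoom of `typeIZoom_ancientMild_limit_parabolic` (`λ_j² (−s) = ν (T − t_j)`) this is
`≈ (−s)|Ω(y)|/(T − t_j)`: the door is only ever used at points whose vorticity is at least a fixed
multiple `κ` of the ODE rate `1/(T − t)` — NEAR-MAXIMUM points in the Type-I sense. Hence the door can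
be weakened to

  W3ⁿᵐ (near-maximum scaled top alignment): for every classical Leray–Hopf solution from a rapidly
  decaying datum on `[0,T)` and all `κ > 0`, `λ ∈ (0,1)`, `R > 0`, `ε > 0` there is `M > 0` such that
  for `t ∈ (0,T)` and `x` with `|ω(t,x)| ≥ M` AND `|ω(t,x)| ≥ κ/(T − t)`, every `y` with
  `λ|ω(t,x)| ≤ |ω(t,y)|`, `|x − y| ≤ R√(ν/|ω(t,x)|)` has direction sine `≤ ε`

(W3 ⇒ W3ⁿᵐ trivially: drop the extra hypothesis), and this file proves

* `dirSine_limit_eq_zero_of_nearMaxScaledTopAligned` — W3ⁿᵐ at one solution kills the pairwise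
  direction sines of any PARABOLIC vorticity zoom limit off its zero set;
* `zero_or_signBlindAligned_of_dirSine_eq_zero` — bookkeeping: pairwise sine zero off the zero set
  means zero-or-sign-blind-aligned with one vector;
* **`navierStokesRegularity_of_nearMaxScaledTopAlignment_of_noTypeII`** — W3ⁿᵐ → NoTypeII →
  NavierStokesRegularity (a maximal solution is Type I by NoTypeII; if it did not extend, the parabolic
  Type-I zoom limit `W` would have every slice vorticity zero-or-aligned by the first lemma, hence
  `W ≡ 0` by U = `ancientMild_sliceAlignedVorticity_trivial` — contradicting `W(−1,0) ≠ 0`);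
* `nearMaxScaledTopAlignment_of_aprioriScaledTopAlignment` — W3 ⇒ W3ⁿᵐ.

By `scaledTopSine_le_nearMax_of_scaledAlignment` (`ScaledTopAlignmentW3Rung.lean`) W3ⁿᵐ holds at every
solution satisfying Giga–Miura's (CA′) together with the vorticity rate ceiling `|ω| ≤ K/(T − t)`: the
restricted door sits exactly between the printed hypothesis (CA′) and the route's W3. An OPTION for the
tenure planner (restate W3 → W3ⁿᵐ); nothing here proves W3ⁿᵐ. WHAT THIS IS NOT: not NS regularity.

## References

* Y. Giga, H. Miura, Comm. Math. Phys. 303 (2011) 289–300 = HUPS #956: Thm 1.1, Rmk 1.4, §2.1. [GigaMiura2011]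
* G. Koch, N. Nadirashvili, G. Seregin, V. Šverák, Acta Math. 203 (2009) 83–105, §6. [KochNadirashviliSereginSverak2009]
-/

noncomputable section

-- the summit and its single sub-problem share the name (CONVENTIONS §1), as in every Theorems file
set_option linter.dupNamespace false

open MeasureTheory Set Function Filter Topology
open scoped RealInnerProductSpace

namespace Summit.NavierStokesRegularity.NavierStokesRegularity.Theorems

open Literature.Analysis Literature.Analysis.FluidPDE

/-! ### W3ⁿᵐ along a parabolic zoom -/

/-- **Near-maximum scaled top alignment kills the direction sines of a parabolic zoom limit.** Let
`ω : ℝ → ℝ³ → ℝ³` satisfy W3ⁿᵐ on `(0, T)` (module docstring) and let a vorticity zoom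
`y ↦ (λ_j²/ν) ω(t_j, x_j + λ_j y)` with `t_j ∈ [0,T)`, `t_j → T`, `λ_j → 0⁺` and the parabolic law
`λ_j² (−s) = ν (T − t_j)` (`s < 0`) converge pointwise to `Ω`. Then `sin∠(Ω y, Ω y') = 0` whenever
`Ω y ≠ 0 ≠ Ω y'`: the physical vorticities at the two points are `≈ (−s)|Ω|/(T − t_j) ≥ κ/(T − t_j)`,
comparable (`λ = min(½, |Ω y'|/4|Ω y|)`), within `R√(ν/|ω|)` of each other
(`R = |y − y'|√(2|Ω y|) + 1`) and above any threshold eventually, so W3ⁿᵐ bounds the (scale-invariant)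
sine by every `ε > 0` in the limit. [folklore] -/
theorem dirSine_limit_eq_zero_of_nearMaxScaledTopAligned {ν T : ℝ} (hν : 0 < ν) (hT : 0 < T)
    {ω : ℝ → EuclideanSpace ℝ (Fin 3) → EuclideanSpace ℝ (Fin 3)}
    (hW : ∀ κ : ℝ, 0 < κ → ∀ lam : ℝ, 0 < lam → lam < 1 → ∀ R : ℝ, 0 < R → ∀ ε : ℝ, 0 < ε →
      ∃ M : ℝ, 0 < M ∧ ∀ t ∈ Set.Ioo 0 T, ∀ x y : EuclideanSpace ℝ (Fin 3),
        M ≤ ‖ω t x‖ → κ / (T - t) ≤ ‖ω t x‖ → lam * ‖ω t x‖ ≤ ‖ω t y‖ →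
        ‖x - y‖ ≤ R * Real.sqrt (ν / ‖ω t x‖) →
          Real.sqrt (1 - (inner ℝ (‖ω t x‖⁻¹ • ω t x) (‖ω t y‖⁻¹ • ω t y)) ^ 2) ≤ ε)
    {s : ℝ} (hs : s < 0) {xc : ℕ → EuclideanSpace ℝ (Fin 3)} {t : ℕ → ℝ} {lam : ℕ → ℝ}
    {Ω : EuclideanSpace ℝ (Fin 3) → EuclideanSpace ℝ (Fin 3)}
    (ht : ∀ j, t j ∈ Ico 0 T) (htT : Tendsto t atTop (𝓝 T)) (hlam : ∀ j, 0 < lam j)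
    (hlam0 : Tendsto lam atTop (𝓝 0)) (hpar : ∀ j, lam j ^ 2 * (-s) = ν * (T - t j))
    (hconv : ∀ y, Tendsto (fun j => (lam j ^ 2 / ν) • ω (t j) (xc j + lam j • y)) atTop (𝓝 (Ω y)))
    {y y' : EuclideanSpace ℝ (Fin 3)} (hy : Ω y ≠ 0) (hy' : Ω y' ≠ 0) :
    Real.sqrt (1 - (inner ℝ (‖Ω y‖⁻¹ • Ω y) (‖Ω y'‖⁻¹ • Ω y')) ^ 2) = 0 := by
  -- adapted from the route's deciding theorem `Theses.ScaledTopAlignment.closes` (g3 bookkeeping)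
  set A := ‖Ω y‖ with hAdef
  set B := ‖Ω y'‖ with hBdef
  have hA : 0 < A := norm_pos_iff.mpr hy
  have hB : 0 < B := norm_pos_iff.mpr hy'
  have hc : ∀ j, 0 < lam j ^ 2 / ν := fun j => div_pos (pow_pos (hlam j) 2) hν
  -- the sines of the zoomed vorticities converge to the sine of the limit
  have hlim : Tendsto (fun j => Real.sqrt (1 - (inner ℝ
      (‖(lam j ^ 2 / ν) • ω (t j) (xc j + lam j • y)‖⁻¹ • ((lam j ^ 2 / ν) • ω (t j) (xc j + lam j • y)))
      (‖(lam j ^ 2 / ν) • ω (t j) (xc j + lam j • y')‖⁻¹ • ((lam j ^ 2 / ν) • ω (t j) (xc j + lam j • y')))) ^ 2))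
      atTop (𝓝 (Real.sqrt (1 - (inner ℝ (‖Ω y‖⁻¹ • Ω y) (‖Ω y'‖⁻¹ • Ω y')) ^ 2))) :=
    tendsto_dirSine hy hy' (hconv y) (hconv y')
  -- it suffices to bound the limit by every `ε > 0`
  refine le_antisymm ?_ (dirSine_nonneg _ _)
  refine le_of_forall_pos_le_add fun ε hε => ?_
  rw [zero_add]
  refine le_of_tendsto hlim ?_
  -- norms along the zoom
  have hnA : Tendsto (fun j => ‖(lam j ^ 2 / ν) • ω (t j) (xc j + lam j • y)‖) atTop (𝓝 A) :=
    (hconv y).norm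
  have hnB : Tendsto (fun j => ‖(lam j ^ 2 / ν) • ω (t j) (xc j + lam j • y')‖) atTop (𝓝 B) :=
    (hconv y').norm
  have e1 : ∀ᶠ j in atTop, ‖(lam j ^ 2 / ν) • ω (t j) (xc j + lam j • y)‖ < 2 * A :=
    hnA.eventually_lt_const (by linarith)
  have e2 : ∀ᶠ j in atTop, A / 2 < ‖(lam j ^ 2 / ν) • ω (t j) (xc j + lam j • y)‖ :=
    hnA.eventually_const_lt (by linarith)
  have e3 : ∀ᶠ j in atTop, B / 2 < ‖(lam j ^ 2 / ν) • ω (t j) (xc j + lam j • y')‖ :=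
    hnB.eventually_const_lt (by linarith)
  -- the parameters fed to W3ⁿᵐ
  set lamS := min (1 / 2 : ℝ) (B / (4 * A)) with hlamS
  have hlamS0 : 0 < lamS := lt_min (by norm_num) (by positivity)
  have hlamS1 : lamS < 1 := lt_of_le_of_lt (min_le_left _ _) (by norm_num)
  set RS := ‖y - y'‖ * Real.sqrt (2 * A) + 1 with hRS
  have hRS0 : 0 < RS := by positivity
  set κ : ℝ := A * (-s) / 2 with hκ
  have hκ0 : 0 < κ := by have := neg_pos.2 hs; positivity
  obtain ⟨M, hM0, hM⟩ := hW κ hκ0 lamS hlamS0 hlamS1 RS hRS0 ε hε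
  have e4 : ∀ᶠ j in atTop, lam j < Real.sqrt (A * ν / (2 * M)) :=
    hlam0.eventually_lt_const (Real.sqrt_pos.mpr (by positivity))
  have e5 : ∀ᶠ j in atTop, 0 < t j := htT.eventually_const_lt hT
  filter_upwards [e1, e2, e3, e4, e5] with j h1 h2 h3 h4 h5
  set c := lam j ^ 2 / ν with hcdef
  have hcj : 0 < c := hc j
  set a := ω (t j) (xc j + lam j • y) with hadef
  set b := ω (t j) (xc j + lam j • y') with hbdef
  have hna : ‖c • a‖ = c * ‖a‖ := by rw [norm_smul, Real.norm_of_nonneg hcj.le]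
  have hnb : ‖c • b‖ = c * ‖b‖ := by rw [norm_smul, Real.norm_of_nonneg hcj.le]
  rw [hna] at h1 h2
  rw [hnb] at h3
  have hTt : 0 < T - t j := sub_pos.2 (ht j).2
  -- above the threshold `M`
  have hlam2 : lam j ^ 2 < A * ν / (2 * M) := by
    have h0 : 0 ≤ lam j := (hlam j).le
    calc lam j ^ 2 = lam j * lam j := by ring
      _ < Real.sqrt (A * ν / (2 * M)) * Real.sqrt (A * ν / (2 * M)) :=
          mul_lt_mul'' h4 h4 h0 h0
      _ = A * ν / (2 * M) := Real.mul_self_sqrt (by positivity)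
  have hcle' : c ≤ A / (2 * M) := by
    rw [hcdef, div_le_iff₀ hν]
    have hr : A / (2 * M) * ν = A * ν / (2 * M) := by ring
    rw [hr]; exact hlam2.le
  have hMa : M ≤ ‖a‖ := by
    have hapos : 0 ≤ ‖a‖ := norm_nonneg _
    have h6 : A / 2 < A / (2 * M) * ‖a‖ := lt_of_lt_of_le h2 (mul_le_mul_of_nonneg_right hcle' hapos)
    have h7 : M * (A / 2) < M * (A / (2 * M) * ‖a‖) := mul_lt_mul_of_pos_left h6 hM0
    have hsimp : M * (A / (2 * M) * ‖a‖) = A / 2 * ‖a‖ := by field_simp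
    rw [hsimp] at h7
    have hA2 : 0 < A / 2 := by linarith
    nlinarith
  -- NEAR-MAXIMUM: `κ/(T − t_j) ≤ |a|`, since `ν/λ_j² = (−s)/(T − t_j)` and `c|a| > A/2`
  have hκa : κ / (T - t j) ≤ ‖a‖ := by
    rw [div_le_iff₀ hTt, hκ]
    -- `c ‖a‖ > A/2` with `c = λ²/ν`, and `λ² (−s) = ν (T − t)`:
    -- `‖a‖ (T − t) = ‖a‖ λ² (−s)/ν = c ‖a‖ (−s) > (A/2)(−s)`
    have hTeq : T - t j = lam j ^ 2 * (-s) / ν := by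
      rw [hpar j]; field_simp
    rw [hTeq]
    have hs' : 0 < -s := neg_pos.2 hs
    have : A / 2 * (-s) < c * ‖a‖ * (-s) := mul_lt_mul_of_pos_right h2 hs'
    have e : ‖a‖ * (lam j ^ 2 * (-s) / ν) = c * ‖a‖ * (-s) := by rw [hcdef]; ring
    rw [e]
    linarith
  -- comparable amplitudes
  have hlamab : lamS * ‖a‖ ≤ ‖b‖ := by
    have hl : lamS ≤ B / (4 * A) := min_le_right _ _
    have ha2 : ‖a‖ ≤ 2 * A / c := by
      rw [le_div_iff₀ hcj]; linarith [h1]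
    have hb2 : B / (2 * c) ≤ ‖b‖ := by
      rw [div_le_iff₀ (by positivity)]; nlinarith [h3]
    calc lamS * ‖a‖ ≤ B / (4 * A) * (2 * A / c) :=
          mul_le_mul hl ha2 (norm_nonneg _) (by positivity)
      _ = B / (2 * c) := by field_simp; ring
      _ ≤ ‖b‖ := hb2
  -- within the amplitude radius
  have hdist : ‖(xc j + lam j • y) - (xc j + lam j • y')‖ ≤ RS * Real.sqrt (ν / ‖a‖) := by
    have hxy : (xc j + lam j • y) - (xc j + lam j • y') = lam j • (y - y') := by
      rw [smul_sub]; abel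
    rw [hxy, norm_smul, Real.norm_of_nonneg (hlam j).le]
    have hapos : 0 < ‖a‖ := lt_of_lt_of_le hM0 hMa
    have hq : lam j ^ 2 / (2 * A) ≤ ν / ‖a‖ := by
      rw [div_le_div_iff₀ (by positivity) hapos]
      have ha2 : c * ‖a‖ < 2 * A := h1
      rw [hcdef] at ha2
      have : lam j ^ 2 * ‖a‖ < 2 * A * ν := by
        have := (div_mul_eq_mul_div (lam j ^ 2) ν ‖a‖).symm ▸ ha2
        rwa [div_lt_iff₀ hν] at this
      linarith
    have hsq : lam j / Real.sqrt (2 * A) ≤ Real.sqrt (ν / ‖a‖) := by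
      have : Real.sqrt (lam j ^ 2 / (2 * A)) = lam j / Real.sqrt (2 * A) := by
        rw [Real.sqrt_div' _ , Real.sqrt_sq (hlam j).le]
        positivity
      rw [← this]; exact Real.sqrt_le_sqrt hq
    have hs2A : 0 < Real.sqrt (2 * A) := Real.sqrt_pos.mpr (by linarith)
    calc lam j * ‖y - y'‖ = (lam j / Real.sqrt (2 * A)) * (‖y - y'‖ * Real.sqrt (2 * A)) := by
          field_simp
      _ ≤ Real.sqrt (ν / ‖a‖) * (‖y - y'‖ * Real.sqrt (2 * A)) :=
          mul_le_mul_of_nonneg_right hsq (by positivity)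
      _ ≤ Real.sqrt (ν / ‖a‖) * RS := by
          apply mul_le_mul_of_nonneg_left _ (Real.sqrt_nonneg _)
          rw [hRS]; linarith
      _ = RS * Real.sqrt (ν / ‖a‖) := mul_comm _ _
  -- W3ⁿᵐ at the pair, and scale invariance of the sine
  have hfin : Real.sqrt (1 - (inner ℝ (‖a‖⁻¹ • a) (‖b‖⁻¹ • b)) ^ 2) ≤ ε :=
    hM (t j) ⟨h5, (ht j).2⟩ _ _ hMa hκa hlamab hdist
  rw [dirSine_smul_pos hcj]
  exact hfin

/-! ### Bookkeeping: pairwise sine zero off the zero set = zero or sign-blind aligned -/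

/-- If the direction sine of `Ω y`, `Ω y'` vanishes whenever both are non-zero, then `Ω` is identically
zero or every value is sign-blind aligned with one non-zero vector `e = Ω y₀`
(`⟪Ω y, e⟫² = ‖Ω y‖²‖e‖²`: equality in Cauchy–Schwarz). [folklore] -/
theorem zero_or_signBlindAligned_of_dirSine_eq_zero
    {Ω : EuclideanSpace ℝ (Fin 3) → EuclideanSpace ℝ (Fin 3)}
    (hs : ∀ y₀ y : EuclideanSpace ℝ (Fin 3), Ω y₀ ≠ 0 → Ω y ≠ 0 →
      Real.sqrt (1 - (inner ℝ (‖Ω y₀‖⁻¹ • Ω y₀) (‖Ω y‖⁻¹ • Ω y)) ^ 2) = 0) :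
    (∀ y, Ω y = 0) ∨ ∃ e : EuclideanSpace ℝ (Fin 3), e ≠ 0 ∧
      ∀ y, ⟪Ω y, e⟫ ^ 2 = ‖Ω y‖ ^ 2 * ‖e‖ ^ 2 := by
  -- adapted from `navierStokesRegularity_of_aprioriScaledBulkAlignment_of_noTypeII` (g0), last block
  by_cases h0 : ∀ y, Ω y = 0
  · exact Or.inl h0
  push Not at h0
  obtain ⟨y₀, hy₀⟩ := h0
  refine Or.inr ⟨Ω y₀, hy₀, fun y => ?_⟩
  by_cases hy0 : Ω y = 0
  · simp [hy0]
  have hy : Ω y ≠ 0 := hy0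
  set cc : ℝ := inner ℝ (‖Ω y‖⁻¹ • Ω y) (‖Ω y₀‖⁻¹ • Ω y₀) with hcc
  have hzero : Real.sqrt (1 - cc ^ 2) = 0 := hs y y₀ hy hy₀
  have hc1 : 1 ≤ cc ^ 2 := by
    have := Real.sqrt_eq_zero'.mp hzero
    linarith
  have hny : ‖Ω y‖ ≠ 0 := norm_ne_zero_iff.mpr hy
  have hny₀ : ‖Ω y₀‖ ≠ 0 := norm_ne_zero_iff.mpr hy₀
  have hcval : cc = (‖Ω y‖⁻¹ * ‖Ω y₀‖⁻¹) * inner ℝ (Ω y) (Ω y₀) := by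
    rw [hcc, real_inner_smul_left, real_inner_smul_right]; ring
  have hCS : (inner ℝ (Ω y) (Ω y₀)) ^ 2 ≤ ‖Ω y‖ ^ 2 * ‖Ω y₀‖ ^ 2 := by
    have h1 := abs_real_inner_le_norm (Ω y) (Ω y₀)
    have h2 : 0 ≤ ‖Ω y‖ * ‖Ω y₀‖ := by positivity
    calc (inner ℝ (Ω y) (Ω y₀)) ^ 2 = |inner ℝ (Ω y) (Ω y₀)| ^ 2 := by rw [sq_abs]
      _ ≤ (‖Ω y‖ * ‖Ω y₀‖) ^ 2 := by
          nlinarith [h1, abs_nonneg (inner ℝ (Ω y) (Ω y₀))]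
      _ = ‖Ω y‖ ^ 2 * ‖Ω y₀‖ ^ 2 := by ring
  have hge : ‖Ω y‖ ^ 2 * ‖Ω y₀‖ ^ 2 ≤ (inner ℝ (Ω y) (Ω y₀)) ^ 2 := by
    rw [hcval] at hc1
    have hpos : 0 < ‖Ω y‖ ^ 2 * ‖Ω y₀‖ ^ 2 := by positivity
    have : 1 ≤ ((‖Ω y‖⁻¹ * ‖Ω y₀‖⁻¹) * inner ℝ (Ω y) (Ω y₀)) ^ 2 := hc1
    have hrew : ((‖Ω y‖⁻¹ * ‖Ω y₀‖⁻¹) * inner ℝ (Ω y) (Ω y₀)) ^ 2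
        = (inner ℝ (Ω y) (Ω y₀)) ^ 2 / (‖Ω y‖ ^ 2 * ‖Ω y₀‖ ^ 2) := by
      field_simp
    rw [hrew, le_div_iff₀ hpos] at this
    linarith
  exact le_antisymm hCS hge

/-! ### The bridge: W3ⁿᵐ + NoTypeII ⇒ Clay (A) -/

/-- **Near-maximum scaled top alignment plus no Type II gives Clay (A).** If every classical
Leray–Hopf solution from a rapidly decaying datum satisfies W3ⁿᵐ (scaled sign-blind alignment of the
relative top set within the amplitude radius, required ONLY at points with `|ω(t,x)| ≥ κ/(T − t)`, for
every `κ > 0`; module docstring) and the route's residual hard core NoTypeII holds, then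
`NavierStokesRegularity`. Proof: `TypeILiouville.Assembly_holds` reduces (A) to «no blow-up»; a maximal
solution blowing up at `T` is Type I (NoTypeII) and bounded on closed sub-strips
(`liouvilleKillsTypeI_exists_bound_Icc`); its parabolic Type-I zoom limit `W`
(`typeIZoom_ancientMild_limit_parabolic`) has, by `dirSine_limit_eq_zero_of_nearMaxScaledTopAligned` and
`zero_or_signBlindAligned_of_dirSine_eq_zero`, every slice vorticity zero-or-aligned, so `W ≡ 0` by
U = `ancientMild_sliceAlignedVorticity_trivial` (Giga–Miura §2.1 + KNSS) — contradicting `W(−1,0) ≠ 0`.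
The restricted door W3ⁿᵐ is implied by W3 (`nearMaxScaledTopAlignment_of_aprioriScaledTopAlignment`) and,
under the vorticity rate ceiling, by Giga–Miura's (CA′) (`scaledTopSine_le_nearMax_of_scaledAlignment`).
[cite: GigaMiura2011, Thm 1.1 with Rmk 1.4 and §2.1 (HUPS preprint #956 pp. 3–9)] -/
theorem navierStokesRegularity_of_nearMaxScaledTopAlignment_of_noTypeII
    (hW : ∀ (ν T : ℝ), 0 < ν → 0 < T → ∀ (u : ℝ → EuclideanSpace ℝ (Fin 3) → EuclideanSpace ℝ (Fin 3))
      (p : ℝ → EuclideanSpace ℝ (Fin 3) → ℝ),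
      Literature.Analysis.FluidPDE.IsClassicalNSSolutionOn (Set.Ico 0 T) ν 0 u p →
      Literature.Analysis.FluidPDE.IsLerayHopfOn T ν 0 (u 0) u →
      Literature.Analysis.FluidPDE.HasRapidSpatialDecay (u 0) →
      ∀ κ : ℝ, 0 < κ → ∀ lam : ℝ, 0 < lam → lam < 1 → ∀ R : ℝ, 0 < R → ∀ ε : ℝ, 0 < ε →
      ∃ M : ℝ, 0 < M ∧ ∀ t ∈ Set.Ioo 0 T, ∀ x y : EuclideanSpace ℝ (Fin 3),
        M ≤ ‖Literature.Analysis.FluidPDE.curl (u t) x‖ →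
        κ / (T - t) ≤ ‖Literature.Analysis.FluidPDE.curl (u t) x‖ →
        lam * ‖Literature.Analysis.FluidPDE.curl (u t) x‖ ≤ ‖Literature.Analysis.FluidPDE.curl (u t) y‖ →
        ‖x - y‖ ≤ R * Real.sqrt (ν / ‖Literature.Analysis.FluidPDE.curl (u t) x‖) →
          Real.sqrt (1 - (inner ℝ (‖Literature.Analysis.FluidPDE.curl (u t) x‖⁻¹ •
              Literature.Analysis.FluidPDE.curl (u t) x)
            (‖Literature.Analysis.FluidPDE.curl (u t) y‖⁻¹ • Literature.Analysis.FluidPDE.curl (u t) y)) ^ 2)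
            ≤ ε)
    (hII : Summit.NavierStokesRegularity.NavierStokesRegularity.Theses.ScaledTopAlignment.NoTypeII) :
    _root_.NavierStokesRegularity := by
  apply Summit.NavierStokesRegularity.NavierStokesRegularity.Theses.TypeILiouville.Assembly_holds
  intro ν T hν hT u p hcl hLH hdec
  by_contra hext
  have hmax : Literature.Analysis.FluidPDE.IsMaximalSmoothSolution ν 0 u p T := ⟨hcl, hext⟩
  have hI : Literature.Analysis.FluidPDE.IsTypeIBlowup u T := hII ν T hν hT u p hmax hLH hdec
  have hbdd : ∀ T' < T, ∃ M : ℝ, ∀ s ∈ Set.Icc 0 T', ∀ x, ‖u s x‖ ≤ M := by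
    intro T' hT'
    by_cases h : 0 < T'
    · exact liouvilleKillsTypeI_exists_bound_Icc hν hcl hLH hdec ⟨h, hT'⟩
    · obtain ⟨M, hM⟩ := liouvilleKillsTypeI_exists_bound_Icc hν hcl hLH hdec (T' := T / 2)
        ⟨by linarith, by linarith⟩
      push Not at h
      exact ⟨M, fun s hs x => hM s ⟨hs.1, by linarith [hs.2]⟩ x⟩
  obtain ⟨C, W, hWcl, hW0, hzoom⟩ :=
    typeIZoom_ancientMild_limit_parabolic hν hT hcl hLH hbdd hI hext
  have hfam := hW ν T hν hT u p hcl hLH hdec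
  have hal : ∀ s < (0 : ℝ), (∀ y, curl (W s) y = 0) ∨
      ∃ e : EuclideanSpace ℝ (Fin 3), e ≠ 0 ∧
        ∀ y, ⟪curl (W s) y, e⟫ ^ 2 = ‖curl (W s) y‖ ^ 2 * ‖e‖ ^ 2 := by
    intro s hs
    obtain ⟨xc, t, lam, ht, htT, hlam, hlam0, hpar, hconv⟩ := hzoom s hs
    exact zero_or_signBlindAligned_of_dirSine_eq_zero fun y₀ y hy₀ hy =>
      dirSine_limit_eq_zero_of_nearMaxScaledTopAligned hν hT (ω := fun τ => curl (u τ)) hfam hs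
        ht htT hlam hlam0 hpar hconv hy₀ hy
  exact hW0 (ancientMild_sliceAlignedVorticity_trivial hWcl hal (-1) (by norm_num) 0)

/-- **W3 ⇒ W3ⁿᵐ**: the route's door `AprioriScaledTopAlignment` (stmt-NavierStokesRegularity-19901) implies
its near-maximum restriction (drop the extra hypothesis `κ/(T − t) ≤ |ω(t,x)|` and restrict
`t ∈ [0,T)` to `(0,T)`). [folklore] -/
theorem nearMaxScaledTopAlignment_of_aprioriScaledTopAlignment
    (hW3 : Summit.NavierStokesRegularity.NavierStokesRegularity.Theses.ScaledTopAlignment.AprioriScaledTopAlignment) :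
    ∀ (ν T : ℝ), 0 < ν → 0 < T → ∀ (u : ℝ → EuclideanSpace ℝ (Fin 3) → EuclideanSpace ℝ (Fin 3))
      (p : ℝ → EuclideanSpace ℝ (Fin 3) → ℝ),
      Literature.Analysis.FluidPDE.IsClassicalNSSolutionOn (Set.Ico 0 T) ν 0 u p →
      Literature.Analysis.FluidPDE.IsLerayHopfOn T ν 0 (u 0) u →
      Literature.Analysis.FluidPDE.HasRapidSpatialDecay (u 0) →
      ∀ κ : ℝ, 0 < κ → ∀ lam : ℝ, 0 < lam → lam < 1 → ∀ R : ℝ, 0 < R → ∀ ε : ℝ, 0 < ε →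
      ∃ M : ℝ, 0 < M ∧ ∀ t ∈ Set.Ioo 0 T, ∀ x y : EuclideanSpace ℝ (Fin 3),
        M ≤ ‖Literature.Analysis.FluidPDE.curl (u t) x‖ →
        κ / (T - t) ≤ ‖Literature.Analysis.FluidPDE.curl (u t) x‖ →
        lam * ‖Literature.Analysis.FluidPDE.curl (u t) x‖ ≤ ‖Literature.Analysis.FluidPDE.curl (u t) y‖ →
        ‖x - y‖ ≤ R * Real.sqrt (ν / ‖Literature.Analysis.FluidPDE.curl (u t) x‖) →
          Real.sqrt (1 - (inner ℝ (‖Literature.Analysis.FluidPDE.curl (u t) x‖⁻¹ •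
              Literature.Analysis.FluidPDE.curl (u t) x)
            (‖Literature.Analysis.FluidPDE.curl (u t) y‖⁻¹ • Literature.Analysis.FluidPDE.curl (u t) y)) ^ 2)
            ≤ ε := by
  intro ν T hν hT u p hcl hLH hdec κ _hκ lam hlam hlam1 R hR ε hε
  obtain ⟨M, hM, h⟩ := hW3 ν T hν hT u p hcl hLH hdec lam hlam hlam1 R hR ε hε
  exact ⟨M, hM, fun t ht x y hMx _hκx hlamy hxy => h t ⟨ht.1.le, ht.2⟩ x y hMx hlamy hxy⟩

end Summit.NavierStokesRegularity.NavierStokesRegularity.Theorems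

end
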